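import Summits.BirchSwinnertonDyer.BirchSwinnertonDyer.Theorems.QuadraticBranchSignedControlPlusEtaLowerInclusionValuationSqueezeOrder
import Literature.NumberTheory.EllipticCurves.IwasawaEulerCharProofs
import Literature.NumberTheory.EllipticCurves.KatoRankBoundProofs
import Literature.NumberTheory.EllipticCurves.KitajimaOtsuki2018.EtaSelmerNoFiniteSubmodule
import HarnessLib

/-!
# Route `QuadraticBranchSignedControl` (rung K8, cell `bsd-potss`), crux `PlusEtaLowerInclusion`
# (item stmt-BirchSwinnertonDyer-19601): the LEADING COEFFICIENT of `Char X⁺(V/K_∞)^η` at a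
# tower-onto pair IS the order of the cokernel of `φ : X_η[T] → X_η/TX_η` — the valuation squeeze in
# SELMER SHAPE for every Mordell–Weil rank

WHAT. Third file of the valuation-squeeze road (p499967, p500695): there (E⁺_η) at a tower-onto
pair of rank `r = rank V^{(p*)}(ℚ)` was reduced to `p^v ∣ coeff_r ξ_η` (`ξ_η` the characteristic power
series of `X_η = X⁺(V/K₀ℚ_∞)^η`, `v = v_p(coeff_r L_p⁺(V, η, T))`). THIS FILE makes it a GROUP ORDER:

  GRANTED Kobayashi Thm. 1.2 / 1.3 / 2.2(η) / 4.1(η) and Kitajima–Otsuki Thm. 1.3 at `η` (NAMED facts)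
  + tower onto + the `V`-certificate + `coeff_r L_p⁺(V,η,T) ≠ 0` (finite computation per pair):
  `coeff_r ξ_η = u · #coker(φ_{X_η} : X_η[T] → X_η/TX_η)`, `u ∈ ℤ_p^×`,

the truncated `Γ`-Euler characteristic (`IwasawaAlgebra.coeff_charGenerator_mul_card_ker_bockstein_of_order_eq`,
CSS 2003 §3 (31), PROVED in the tree) with `ker φ = 0`: (a) `X_η` is `T`-SEMISIMPLE at the pair —
`ord_T ξ_η = r` (p500695) and, by the decomposition frame, `rank V + r = rank V'(F) ≤
rank (X_ℚ × X_η)/T ≤ ord_T(ξ_ℚ ξ_η) = rank V + r`, so `ker φ_{X_ℚ × X_η}` is finite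
(`order_charGenerator_eq_coinvariantsRank_iff_finite_ker_bockstein`) and with it `ker φ_{X_η}`;
(b) Kitajima–Otsuki at `η`: a finite `Λ`-submodule of `X_η` is `0`. CONSEQUENCE (§3), SELMER SHAPE:

  (E⁺_η)(V, p) ⟸ named facts + certificates + `p^{v} ∣ #coker φ_{X_η}` for every `η`-datum,

the rank-`r` form of k8-rung's rank-zero Selmer-shape road (`r = 0`: `X_η[T] = 0`, `coker φ = X_η/TX_η`
= dual of `Sel⁺(V/K_∞)^{η,Γ}`). For `r = 1`: `#coker φ = #(X_η/TX_η)_tors · [(X_η/TX_η)/tors : φ(X_η[T])]`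
(the `p`-adic-height-like index of the tower); nothing about its size is asserted for any pair.

HONEST FRAMING (cell `bsd-potss`, run/shared/lean/pub/bsd-potss/; FULL-BSD rank ≤ 1 programme, HUMAN
RULING D-0036/D-0074): TOOL THEOREMS ONLY, CONDITIONAL on the named Literature facts (Kobayashi 2003
Thm. 1.2/1.3/2.2η/4.1η, Kitajima–Otsuki 2018 Thm. 1.3 at `η`; hypothesis position), on the tower-onto
hypothesis, the `V`-certificate and the analytic certificate (NOT supplied here for any pair), and in §3
on the per-pair Selmer-shape input (OPEN on the rank-one rows). The crux 19601 is OPEN class-wide and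
NOT closed; nothing is booked; `BSD(W, p)` is claimed for no pair. No definition, no named fact, no
`sorry`, axioms standard. Seat `bsd-potss-k8eta-c1` (prover), g3; `--supports stmt-BirchSwinnertonDyer-19601`.

References: [Kobayashi2003] Thm. 1.2/1.3, 2.2, §4 + Thm. 4.1; [KitajimaOtsuki2018] Thm. 1.3;
[CoatesSchneiderSujatha2003] §3 (30)–(31); [GreenbergLNM1716] §1 p. 65, §4 Thm. 4.1; [Washington1997] §13.2.
-/

set_option autoImplicit false
set_option linter.dupNamespace false
noncomputable section

open scoped Classical
open CongruenceSubgroup Field WeierstrassCurve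
open Literature.NumberTheory.EllipticCurves
open Literature.NumberTheory.EllipticCurves.ModularForms
open Literature.NumberTheory.GaloisRepresentations
open Summit.BirchSwinnertonDyer.Rank1Residual.Additive

namespace Summit.BirchSwinnertonDyer.BirchSwinnertonDyer.Theorems

/-! ## §1 Algebra -/
section Algebra

variable {p : ℕ} [Fact p.Prime]

/-- In `Λ = ℤ_p⟦T⟧`: `T^r ∣ g` and `T^{r+1} ∤ g` give `ord_{T=0} g = r`. [folklore] -/
theorem order_eq_of_X_pow_dvd_of_not_X_pow_succ_dvd {r : ℕ} {g : IwasawaAlgebra p}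
    (h₁ : (PowerSeries.X : IwasawaAlgebra p) ^ r ∣ g)
    (h₂ : ¬ (PowerSeries.X : IwasawaAlgebra p) ^ (r + 1) ∣ g) : g.order = r := by
  rw [PowerSeries.order_eq_nat]
  refine ⟨fun h0 => h₂ ?_, fun i hi => PowerSeries.X_pow_dvd_iff.mp h₁ i hi⟩
  rw [PowerSeries.X_pow_dvd_iff]
  intro m hm
  rcases Nat.lt_succ_iff_lt_or_eq.mp hm with hm' | rfl
  · exact PowerSeries.X_pow_dvd_iff.mp h₁ m hm'
  · exact h0

/-- `ker φ_B` embeds into `ker φ_{A × B}` (`x ↦ (0, x)`), so it is finite when the latter is.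
[cite: CoatesSchneiderSujatha2003, §3 (30) (the map φ)] -/
theorem finite_ker_bockstein_of_prod {A B : Type*} [AddCommGroup A] [Module (IwasawaAlgebra p) A]
    [AddCommGroup B] [Module (IwasawaAlgebra p) B]
    (h : Finite (LinearMap.ker (IwasawaAlgebra.bockstein p (A × B)))) :
    Finite (LinearMap.ker (IwasawaAlgebra.bockstein p B)) := by
  -- the embedding
  have hmem : ∀ x : LinearMap.ker (IwasawaAlgebra.bockstein p B),
      ((0 : A), ((x : IwasawaAlgebra.invariants p B) : B)) ∈ IwasawaAlgebra.invariants p (A × B) := by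
    intro x
    rw [IwasawaAlgebra.mem_invariants_iff, Prod.smul_mk, smul_zero, Prod.mk_eq_zero]
    exact ⟨rfl, (IwasawaAlgebra.mem_invariants_iff p B _).mp (x : IwasawaAlgebra.invariants p B).2⟩
  have hker : ∀ x : LinearMap.ker (IwasawaAlgebra.bockstein p B),
      (⟨((0 : A), ((x : IwasawaAlgebra.invariants p B) : B)), hmem x⟩ :
        IwasawaAlgebra.invariants p (A × B)) ∈ LinearMap.ker (IwasawaAlgebra.bockstein p (A × B)) := by
    intro x
    rw [IwasawaAlgebra.mem_ker_bockstein_iff, IwasawaAlgebra.mem_TSubmodule_iff]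
    obtain ⟨y, hy⟩ := (IwasawaAlgebra.mem_TSubmodule_iff p B _).mp
      ((IwasawaAlgebra.mem_ker_bockstein_iff p B _).mp x.2)
    exact ⟨((0 : A), y), by rw [Prod.smul_mk, smul_zero, hy]⟩
  let ι : LinearMap.ker (IwasawaAlgebra.bockstein p B) →
      LinearMap.ker (IwasawaAlgebra.bockstein p (A × B)) := fun x => ⟨_, hker x⟩
  refine Finite.of_injective ι fun x y hxy => ?_
  have h1 := congrArg (fun z : LinearMap.ker (IwasawaAlgebra.bockstein p (A × B)) =>
    (((z : IwasawaAlgebra.invariants p (A × B)) : A × B)).2) hxy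
  exact Subtype.ext (Subtype.ext h1)

end Algebra

/-! ## §2 `T`-semisimplicity of `X_η` at a tower-onto pair -/

section Pair

variable {V : WeierstrassCurve ℚ} [V.IsElliptic] [V.IsGloballyMinimal] {p : ℕ} [Fact p.Prime]

/-- **`X_η` is `T`-semisimple at a tower-onto pair**: GRANTED Kobayashi's Thm. 1.2 / 1.3 / 2.2(η) /
4.1(η) (NAMED facts), on a good `a_p = 0` pair with `p ≥ 5`, `ρ_{V,p^m}` onto, the `V`-certificate and
`coeff_r L_p⁺(V,η,T) ≠ 0` (`r = rank V^{(p*)}(ℚ)`): every characteristic power series `g` of every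
`η`-datum has `ord_{T=0} g = r`, and `ker(φ : X_η[T] → X_η/TX_η)` is FINITE (module docstring (a);
dual datum on `X_ℚ × X_η` as in `etaTransportPlus_of_decomposition`, p418003). CONDITIONAL.
[cite: Kobayashi2003, Thm. 1.2 and Thm. 1.3 (p. 2), Thm. 2.2 (p. 5), Thm. 4.1 and §4 (p. 8)]
[cite: GreenbergLNM1716, §1 p. 65 and §3 Lemma 3.1] [cite: CoatesSchneiderSujatha2003, §3 (30)–(31)] -/
theorem order_eq_twistRank_and_finite_ker_bockstein_of_namedFacts_of_certV_of_coeff_ne_zero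
    (h12 : Kobayashi2003.thm12_signedSelmerDual_finite_torsion)
    (h13 : Kobayashi2003.thm41_signedCharIdeal_divisibility)
    (h22 : Kobayashi2003.thm22_etaSignedSelmerDual_finite_torsion)
    (h41 : Kobayashi2003.thm41_plusEtaCharIdeal_dvd)
    (hp5 : 5 ≤ p) (hgood : V.HasGoodReductionAtPrime p) (hap : V.frobeniusTrace p = 0)
    (hsurj : ∀ m : ℕ, V.HasSurjectiveModNGaloisRep (p ^ m : ℕ))
    (hcertV : ∀ {N : ℕ} [NeZero N] (f : CuspForm (Gamma0 N) 2), IsNewformOf V f →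
      ∃ L : IwasawaAlgebra p, Kobayashi2003.IsSignedPAdicLFunction f p 1 L ∧
        IsUnit (PowerSeries.coeff V.mordellWeilRank L))
    {N : ℕ} [NeZero N] {f : CuspForm (Gamma0 N) 2} (hf : IsNewformOf V f) (ϖ : ℚ)
    (hϖ : if Even (p / 2) then (ϖ : ℝ) * V.realPeriodRat = plusPeriod f
      else (ϖ : ℝ) * V.imaginaryPeriodRat = minusPeriod f)
    (Lη : IwasawaAlgebra p) (hL : IsQuadraticBranchPlusLFunction f p ϖ Lη)
    (hne : PowerSeries.coeff (V.quadraticTwist ((-1) ^ (p / 2) * p)).mordellWeilRank Lη ≠ 0)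
    (K₀ : Type) [Field K₀] [NumberField K₀] [IsCyclotomicExtension {p} ℚ K₀]
    [(galRange (K := ℚ) K₀).Normal] (ηq : absoluteGaloisGroup ℚ →* ℤˣ)
    (hηK : ∀ σ ∈ galRange (K := ℚ) K₀, ηq σ = 1) (hη1 : ηq ≠ 1)
    (κ : ZpExtension ℚ p) (γ : absoluteGaloisGroup ℚ) (hκ : κ.IsCyclotomic) (hγ : κ.IsTopGenerator γ)
    (hγK : γ ∈ galRange (K := ℚ) K₀) (hγc : IsCyclotomicVariable p γ)
    (D : EtaSignedSelmerDualData V κ K₀ ℚ_[p] ηq γ 1) {g : IwasawaAlgebra p}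
    (hg : D.charIdeal = Ideal.span {g}) :
    g.order = (V.quadraticTwist ((-1) ^ (p / 2) * p)).mordellWeilRank ∧
      Finite (LinearMap.ker (IwasawaAlgebra.bockstein p D.X)) := by
  have hp2 : p ≠ 2 := by omega
  -- `ord_T g = r` (p500695)
  obtain ⟨⟨hXg, hXg'⟩, -⟩ :=
    ordT_etaCharGenerator_eq_twistRank_of_namedFacts_of_certV_of_coeff_ne_zero h12 h13 h22 h41 hp5
      hgood hap hsurj (fun f hf => hcertV f hf) hf ϖ hϖ Lη hL hne K₀ ηq hηK hη1 κ γ hκ hγ hγK hγc D hg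
  have hord : g.order = (V.quadraticTwist ((-1) ^ (p / 2) * p)).mordellWeilRank :=
    order_eq_of_X_pow_dvd_of_not_X_pow_succ_dvd hXg hXg'
  refine ⟨hord, ?_⟩
  -- the decomposition frame and the dual datum on `X_ℚ × X_η` (verbatim p418003 / p499967)
  obtain ⟨F, _instF, _instNF, V', _instE, κF, γF, Φ, hF2, hθ, hCV, hκF, hγF, hζ, hΦ⟩ :=
    etaDecomposition p hp5 K₀ ηq hηK hη1 V hgood hap κ γ hκ hγ hγK hγc
  let D₀ : Kobayashi2003.SignedSelmerDualData V κ γ 1 := Kobayashi2003.signedSelmerDualData V κ 1 hγ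
  obtain ⟨h0fin, h0tor⟩ := h12 V p hp2 hgood hap κ γ hκ hγ 1 D₀
  haveI : Module.Finite (IwasawaAlgebra p) D₀.X := h0fin
  obtain ⟨hfin, htor⟩ :=
    EtaSignedSelmerDualData.finite_isTorsion_of_thm22 h22 hηK hp2 hgood hap hκ hγ hγK D
  haveI : Module.Finite (IwasawaAlgebra p) D.X := hfin
  let π₀ : Kobayashi2003.signedSelmerInfty V' κF 1 →+ Kobayashi2003.signedSelmerInfty V κ 1 :=
    (AddMonoidHom.fst _ _).comp Φ.toAddMonoidHom
  let π₁ : Kobayashi2003.signedSelmerInfty V' κF 1 →+ towerSignedSelmerInftyEta V κ K₀ ℚ_[p] ηq 1 :=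
    (AddMonoidHom.snd _ _).comp Φ.toAddMonoidHom
  let T : D₀.X × D.X →+ (Kobayashi2003.signedSelmerInfty V' κF 1 →+ AddCircle (1 : ℚ)) :=
    AddMonoidHom.mk' (fun x => (D₀.toDual x.1).comp π₀ + (D.toDual x.2).comp π₁) (by
      intro x y
      simp only [Prod.fst_add, Prod.snd_add, map_add, AddMonoidHom.add_comp]
      abel)
  have hT : ∀ (x : D₀.X × D.X) (s : Kobayashi2003.signedSelmerInfty V' κF 1),
      T x s = D₀.toDual x.1 (Φ s).1 + D.toDual x.2 (Φ s).2 := fun x s => rfl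
  have hTbij : Function.Bijective T :=
    bijective_dualOfProd Φ D₀.toDual D.toDual D₀.bijective D.bijective
  let DF : Kobayashi2003.SignedSelmerDualData V' κF γF 1 :=
    { X := D₀.X × D.X
      conj_mem := fun s hs => Kobayashi2003.conjH1_mem_signedSelmerInfty V' κF 1 γF hs
      toDual := T
      bijective := hTbij
      toDual_T_smul := by
        intro x s
        have h0 : (Φ ⟨V'.conjH1 p κF.kerSubgroup γF s,
            Kobayashi2003.conjH1_mem_signedSelmerInfty V' κF 1 γF s.2⟩).1 =
            ⟨V.conjH1 p κ.kerSubgroup γ (Φ s).1, D₀.conj_mem _ (Φ s).1.2⟩ :=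
          Subtype.ext (hΦ s).1
        have h1 : (Φ ⟨V'.conjH1 p κF.kerSubgroup γF s,
            Kobayashi2003.conjH1_mem_signedSelmerInfty V' κF 1 γF s.2⟩).2 =
            ⟨V.conjH1 p (towerTopSubgroup κ K₀) γ (Φ s).2, D.conj_mem _ (Φ s).2.2⟩ :=
          Subtype.ext (hΦ s).2
        rw [hT, hT, hT, Prod.smul_fst, Prod.smul_snd, D₀.toDual_T_smul, D.toDual_T_smul, h0, h1]
        abel
      toDual_C_smul := by
        intro c x s k hk
        have hk' : (p ^ k) • Φ s = 0 := by rw [← map_nsmul, hk, map_zero]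
        have hk0 : (p ^ k) • (Φ s).1 = 0 := by
          have := congrArg Prod.fst hk'; simpa using this
        have hk1 : (p ^ k) • (Φ s).2 = 0 := by
          have := congrArg Prod.snd hk'; simpa using this
        rw [hT, hT, Prod.smul_fst, Prod.smul_snd, D₀.toDual_C_smul c x.1 _ k hk0,
          D.toDual_C_smul c x.2 _ k hk1, smul_add] }
  haveI hFfin : Module.Finite (IwasawaAlgebra p) DF.X :=
    inferInstanceAs (Module.Finite (IwasawaAlgebra p) (D₀.X × D.X))
  have hFtor : Module.IsTorsion (IwasawaAlgebra p) DF.X := isTorsion_prod h0tor htor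
  -- `Char X⁺(V'/F_∞) = (ξ · g)`
  obtain ⟨ξ, hξ⟩ := (charIdeal_isPrincipal_holds p D₀.X).principal
  have hξ' : D₀.charIdeal = Ideal.span {ξ} := hξ
  have hmul : DF.charIdeal = D₀.charIdeal * D.charIdeal :=
    charIdeal_mul_of_shortExact_holds p (D₀.X × D.X) hFtor (LinearMap.inl (IwasawaAlgebra p) D₀.X D.X)
      (LinearMap.snd (IwasawaAlgebra p) D₀.X D.X) LinearMap.inl_injective LinearMap.snd_surjective
      .inl_snd
  have hcharF : DF.charIdeal = Ideal.span {ξ * g} := by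
    rw [hmul, hξ', hg, Ideal.span_singleton_mul_span_singleton]
  -- the `V`-side: `ξ = T^{rank V} · unit`, so `ord_T ξ = rank V(ℚ)`
  have hξdvd : (PowerSeries.X : IwasawaAlgebra p) ^ V.mordellWeilRank ∣ ξ :=
    D₀.X_pow_mordellWeilRank_dvd_of_charIdeal_eq_span hγ h0tor hξ'
  obtain ⟨Lp, hLp, hcoefV⟩ := hcertV f hf
  have hLpmem : Lp ∈ D₀.charIdeal :=
    (h13 V p hp2 hgood hap f hf κ γ hκ hγ hγc 1 Lp hLp D₀ h0tor).2 hsurj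
  have hξLp : ξ ∣ Lp := by
    rw [hξ'] at hLpmem
    exact Ideal.mem_span_singleton.mp hLpmem
  obtain ⟨a, ha, hξa⟩ := exists_isUnit_eq_X_pow_mul_of_dvd_of_dvd_of_isUnit_coeff hξdvd hξLp hcoefV
  have horda : a.order = 0 := by
    rw [← Nat.cast_zero, PowerSeries.order_eq_nat]
    refine ⟨?_, fun i hi => (Nat.not_lt_zero i hi).elim⟩
    rw [PowerSeries.coeff_zero_eq_constantCoeff]
    exact (PowerSeries.isUnit_iff_constantCoeff.mp ha).ne_zero
  have hordξ : ξ.order = V.mordellWeilRank := by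
    rw [hξa, PowerSeries.order_mul, PowerSeries.order_X_pow, horda, add_zero]
  have hordF : (ξ * g).order =
      ((V.mordellWeilRank + (V.quadraticTwist ((-1) ^ (p / 2) * p)).mordellWeilRank : ℕ) : ℕ∞) := by
    rw [PowerSeries.order_mul, hordξ, hord, Nat.cast_add]
  -- `rank V'(F) ≤ rank_{ℤ_p} (X_ℚ × X_η)/T ≤ ord_T (ξ g) = rank V'(F)`
  have hle1 : V'.mordellWeilRank ≤ IwasawaAlgebra.coinvariantsRank p DF.X :=
    DF.mordellWeilRank_le_coinvariantsRank hγF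
  rw [mordellWeilRank_model_eq_add V F V' hF2 hθ hCV] at hle1
  have hle2 : (IwasawaAlgebra.coinvariantsRank p DF.X : ℕ∞) ≤ (ξ * g).order :=
    IwasawaAlgebra.coinvariantsRank_le_order_of_mem_charIdeal DF.X hFtor (ξ * g)
      (by rw [show Module.charIdeal (IwasawaAlgebra p) DF.X = DF.charIdeal from rfl, hcharF]
          exact Ideal.mem_span_singleton_self _)
  have heq : (ξ * g).order = (IwasawaAlgebra.coinvariantsRank p DF.X : ℕ∞) := by
    refine le_antisymm ?_ hle2
    rw [hordF]
    exact_mod_cast hle1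
  have hfinF : Finite (LinearMap.ker (IwasawaAlgebra.bockstein p DF.X)) :=
    (IwasawaAlgebra.order_charGenerator_eq_coinvariantsRank_iff_finite_ker_bockstein p DF.X hFtor
      (ξ * g) hcharF).mp heq
  exact finite_ker_bockstein_of_prod hfinF

/-- **THE LEADING COEFFICIENT OF `Char X⁺(V/K_∞)^η` IS `#coker φ_{X_η}` (up to `ℤ_p^×`).** GRANTED
Kobayashi's Thm. 1.2 / 1.3 / 2.2(η) / 4.1(η) AND Kitajima–Otsuki's Thm. 1.3 at `η` (NAMED facts), on a
good `a_p = 0` pair with `p ≥ 5`, `ρ_{V,p^m}` onto, the `V`-certificate and `coeff_r L_p⁺(V,η,T) ≠ 0`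
(`r = rank V^{(p*)}(ℚ)`): for every `η`-datum `D` and generator `g` of `Char(D.X)`,
`coeff_r g = u · #(D.X/TD.X ⧸ φ(D.X[T]))` with `u ∈ ℤ_p^×` — the truncated `Γ`-Euler characteristic
(PROVED in the tree) with `ker φ = 0` by Kitajima–Otsuki (`ker φ` is finite by the previous theorem).
CONDITIONAL on the displayed inputs; asserts nothing on the SIZE of the cokernel.
[cite: Kobayashi2003, Thm. 2.2 (p. 5), Thm. 4.1 and §4 (p. 8)] [cite: KitajimaOtsuki2018, Thm. 1.3]
[cite: CoatesSchneiderSujatha2003, §3 (31) and p. 204] [cite: GreenbergLNM1716, §4 Thm. 4.1] -/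
theorem coeff_twistRank_etaCharGenerator_eq_unit_mul_card_coker_bockstein
    (h12 : Kobayashi2003.thm12_signedSelmerDual_finite_torsion)
    (h13 : Kobayashi2003.thm41_signedCharIdeal_divisibility)
    (h22 : Kobayashi2003.thm22_etaSignedSelmerDual_finite_torsion)
    (h41 : Kobayashi2003.thm41_plusEtaCharIdeal_dvd)
    (hKO : KitajimaOtsuki2018.mainThm13_etaSignedSelmerDual_noFiniteSubmodule)
    (hp5 : 5 ≤ p) (hgood : V.HasGoodReductionAtPrime p) (hap : V.frobeniusTrace p = 0)
    (hsurj : ∀ m : ℕ, V.HasSurjectiveModNGaloisRep (p ^ m : ℕ))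
    (hcertV : ∀ {N : ℕ} [NeZero N] (f : CuspForm (Gamma0 N) 2), IsNewformOf V f →
      ∃ L : IwasawaAlgebra p, Kobayashi2003.IsSignedPAdicLFunction f p 1 L ∧
        IsUnit (PowerSeries.coeff V.mordellWeilRank L))
    {N : ℕ} [NeZero N] {f : CuspForm (Gamma0 N) 2} (hf : IsNewformOf V f) (ϖ : ℚ)
    (hϖ : if Even (p / 2) then (ϖ : ℝ) * V.realPeriodRat = plusPeriod f
      else (ϖ : ℝ) * V.imaginaryPeriodRat = minusPeriod f)
    (Lη : IwasawaAlgebra p) (hL : IsQuadraticBranchPlusLFunction f p ϖ Lη)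
    (hne : PowerSeries.coeff (V.quadraticTwist ((-1) ^ (p / 2) * p)).mordellWeilRank Lη ≠ 0)
    (K₀ : Type) [Field K₀] [NumberField K₀] [IsCyclotomicExtension {p} ℚ K₀]
    [(galRange (K := ℚ) K₀).Normal] (ηq : absoluteGaloisGroup ℚ →* ℤˣ)
    (hηK : ∀ σ ∈ galRange (K := ℚ) K₀, ηq σ = 1) (hη1 : ηq ≠ 1)
    (κ : ZpExtension ℚ p) (γ : absoluteGaloisGroup ℚ) (hκ : κ.IsCyclotomic) (hγ : κ.IsTopGenerator γ)
    (hγK : γ ∈ galRange (K := ℚ) K₀) (hγc : IsCyclotomicVariable p γ)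
    (D : EtaSignedSelmerDualData V κ K₀ ℚ_[p] ηq γ 1) {g : IwasawaAlgebra p}
    (hg : D.charIdeal = Ideal.span {g}) :
    ∃ u : ℤ_[p]ˣ, PowerSeries.coeff (V.quadraticTwist ((-1) ^ (p / 2) * p)).mordellWeilRank g =
      u * Nat.card (IwasawaAlgebra.coinvariants p D.X ⧸
        LinearMap.range (IwasawaAlgebra.bockstein p D.X)) := by
  have hp2 : p ≠ 2 := by omega
  obtain ⟨hfin, htor⟩ :=
    EtaSignedSelmerDualData.finite_isTorsion_of_thm22 h22 hηK hp2 hgood hap hκ hγ hγK D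
  haveI : Module.Finite (IwasawaAlgebra p) D.X := hfin
  obtain ⟨hord, hkfin⟩ :=
    order_eq_twistRank_and_finite_ker_bockstein_of_namedFacts_of_certV_of_coeff_ne_zero h12 h13 h22
      h41 hp5 hgood hap hsurj (fun f hf => hcertV f hf) hf ϖ hϖ Lη hL hne K₀ ηq hηK hη1 κ γ hκ hγ hγK
      hγc D hg
  -- Kitajima–Otsuki at `η`: the finite submodule `ker φ ⊆ X_η` vanishes
  haveI := hkfin
  have hmapfin : Finite ((LinearMap.ker (IwasawaAlgebra.bockstein p D.X)).map
      (IwasawaAlgebra.invariants p D.X).subtype) := by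
    refine Finite.of_surjective
      (fun x : LinearMap.ker (IwasawaAlgebra.bockstein p D.X) =>
        (⟨(IwasawaAlgebra.invariants p D.X).subtype x, Submodule.mem_map_of_mem x.2⟩ :
          (LinearMap.ker (IwasawaAlgebra.bockstein p D.X)).map
            (IwasawaAlgebra.invariants p D.X).subtype)) ?_
    rintro ⟨y, hy⟩
    obtain ⟨x, hx, rfl⟩ := Submodule.mem_map.mp hy
    exact ⟨⟨x, hx⟩, rfl⟩
  have hbot : (LinearMap.ker (IwasawaAlgebra.bockstein p D.X)).map
      (IwasawaAlgebra.invariants p D.X).subtype = ⊥ :=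
    hKO p K₀ ηq hηK V hp2 hgood hap κ γ hκ hγ hγK 1 D.toLiterature hfin htor _ hmapfin
  have hker : LinearMap.ker (IwasawaAlgebra.bockstein p D.X) = ⊥ := by
    rw [Submodule.eq_bot_iff]
    intro x hx
    have hx' : (IwasawaAlgebra.invariants p D.X).subtype x ∈
        (LinearMap.ker (IwasawaAlgebra.bockstein p D.X)).map
          (IwasawaAlgebra.invariants p D.X).subtype := Submodule.mem_map_of_mem hx
    rw [hbot, Submodule.mem_bot, Submodule.subtype_apply] at hx'
    exact Subtype.ext hx'
  have hcard : Nat.card (LinearMap.ker (IwasawaAlgebra.bockstein p D.X)) = 1 := by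
    rw [hker]
    exact Nat.card_unique
  obtain ⟨u, hu⟩ := IwasawaAlgebra.coeff_charGenerator_mul_card_ker_bockstein_of_order_eq p D.X htor g
    hg hord hkfin
  refine ⟨u, ?_⟩
  rw [hcard, Nat.cast_one, mul_one] at hu
  exact hu

/-! ## §3 The crux at a tower-onto pair of rank `r` in SELMER SHAPE -/

/-- **(E⁺_η) AT A TOWER-ONTO PAIR OF ANY RANK, SELMER SHAPE.** GRANTED Kobayashi's Thm. 1.2 / 1.3 /
2.2(η) / 4.1(η) and Kitajima–Otsuki's Thm. 1.3 at `η` (NAMED facts), `p ≥ 5`, `V` good with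
`a_p = 0`, `ρ_{V,p^m}` onto, the `V`-certificate, ONE integer `v` with the ANALYTIC certificate
`p^{v+1} ∤ coeff_r L_p⁺(V,η,T)` (`r = rank V^{(p*)}(ℚ)`) and the SELMER-SHAPE input
`p^v ∣ #coker(φ : X_η[T] → X_η/TX_η)` for every `η`-datum: (E⁺_η)(V, p). (§2: `coeff_r ξ_η ~ #coker φ`;
then the valuation squeeze of p499967.) For `r = 0` the input reads `p^v ∣ #X_η/TX_η` (k8-rung's
Selmer-shape road in `η`-currency); for `r = 1` it is the OPEN per-pair content of crux 19601 on the
21 rank-one tower-onto rows. CONDITIONAL; asserts nothing class-wide; closes nothing.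
[cite: Kobayashi2003, Thm. 2.2 (p. 5), Thm. 4.1 and §4 (p. 8)] [cite: KitajimaOtsuki2018, Thm. 1.3]
[cite: CoatesSchneiderSujatha2003, §3 (31)] -/
theorem quadraticBranchPlusEtaLowerInclusionAt_of_namedFacts_of_certV_of_cokerBocksteinDvd
    (h12 : Kobayashi2003.thm12_signedSelmerDual_finite_torsion)
    (h13 : Kobayashi2003.thm41_signedCharIdeal_divisibility)
    (h22 : Kobayashi2003.thm22_etaSignedSelmerDual_finite_torsion)
    (h41 : Kobayashi2003.thm41_plusEtaCharIdeal_dvd)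
    (hKO : KitajimaOtsuki2018.mainThm13_etaSignedSelmerDual_noFiniteSubmodule)
    (hp5 : 5 ≤ p) (hgood : V.HasGoodReductionAtPrime p) (hap : V.frobeniusTrace p = 0)
    (hsurj : ∀ m : ℕ, V.HasSurjectiveModNGaloisRep (p ^ m : ℕ))
    (hcertV : ∀ {N : ℕ} [NeZero N] (f : CuspForm (Gamma0 N) 2), IsNewformOf V f →
      ∃ L : IwasawaAlgebra p, Kobayashi2003.IsSignedPAdicLFunction f p 1 L ∧
        IsUnit (PowerSeries.coeff V.mordellWeilRank L))
    (v : ℕ)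
    (han : ∀ {N : ℕ} [NeZero N] {f : CuspForm (Gamma0 N) 2}, IsNewformOf V f →
      ∀ (ϖ : ℚ), (if Even (p / 2) then (ϖ : ℝ) * V.realPeriodRat = plusPeriod f
          else (ϖ : ℝ) * V.imaginaryPeriodRat = minusPeriod f) →
      ∀ (Lη : IwasawaAlgebra p), IsQuadraticBranchPlusLFunction f p ϖ Lη →
        ¬ (p : ℤ_[p]) ^ (v + 1) ∣
          PowerSeries.coeff (V.quadraticTwist ((-1) ^ (p / 2) * p)).mordellWeilRank Lη)
    (hsel : ∀ (K₀ : Type) [Field K₀] [NumberField K₀] [IsCyclotomicExtension {p} ℚ K₀]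
      [(galRange (K := ℚ) K₀).Normal] (ηq : absoluteGaloisGroup ℚ →* ℤˣ),
      (∀ σ ∈ galRange (K := ℚ) K₀, ηq σ = 1) → ηq ≠ 1 →
      ∀ (κ : ZpExtension ℚ p) (γ : absoluteGaloisGroup ℚ),
        κ.IsCyclotomic → κ.IsTopGenerator γ → γ ∈ galRange (K := ℚ) K₀ → IsCyclotomicVariable p γ →
      ∀ (D : EtaSignedSelmerDualData V κ K₀ ℚ_[p] ηq γ 1),
        p ^ v ∣ Nat.card (IwasawaAlgebra.coinvariants p D.X ⧸
          LinearMap.range (IwasawaAlgebra.bockstein p D.X))) :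
    QuadraticBranchPlusEtaLowerInclusionAt V p := by
  intro K₀ _ _ _ _ ηq hηK hη1 N _ f hp2 hgood' hap' hf ϖ hϖ Lη hL κ γ hκ hγ hγK hγc D
  obtain ⟨hfin, htor⟩ :=
    EtaSignedSelmerDualData.finite_isTorsion_of_thm22 h22 hηK hp2 hgood' hap' hκ hγ hγK D
  haveI : Module.Finite (IwasawaAlgebra p) D.X := hfin
  obtain ⟨g, hg⟩ := (charIdeal_isPrincipal_holds p D.X).principal
  have hg' : D.charIdeal = Ideal.span {g} := hg
  -- Kato side: `g ∣ Lη`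
  obtain ⟨-, hup⟩ := EtaSignedSelmerDualData.thm41_plus_of_facts h22 h41 hηK hη1 hp2 hgood' hap' hf
    ϖ hϖ Lη hL hκ hγ hγK hγc D
  have hgL : g ∣ Lη := by
    have h := hup hsurj
    rw [hg', Ideal.span_singleton_le_span_singleton] at h
    exact h
  have hanL := han hf ϖ hϖ Lη hL
  have hne : PowerSeries.coeff (V.quadraticTwist ((-1) ^ (p / 2) * p)).mordellWeilRank Lη ≠ 0 :=
    fun h0 => hanL (by rw [h0]; exact dvd_zero _)
  -- rank bound and leading coefficient
  have hXg := X_pow_twistRank_dvd_etaCharGenerator_of_namedFacts_of_certV h12 h13 h22 hp5 hgood hap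
    hsurj (fun f hf => hcertV f hf) hf K₀ ηq hηK hη1 κ γ hκ hγ hγK hγc D hg'
  obtain ⟨u, hu⟩ := coeff_twistRank_etaCharGenerator_eq_unit_mul_card_coker_bockstein h12 h13 h22 h41
    hKO hp5 hgood hap hsurj (fun f hf => hcertV f hf) hf ϖ hϖ Lη hL hne K₀ ηq hηK hη1 κ γ hκ hγ hγK hγc
    D hg'
  have halg : (p : ℤ_[p]) ^ v ∣
      PowerSeries.coeff (V.quadraticTwist ((-1) ^ (p / 2) * p)).mordellWeilRank g := by
    rw [hu]
    obtain ⟨c, hc⟩ := hsel K₀ ηq hηK hη1 κ γ hκ hγ hγK hγc D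
    refine Dvd.dvd.mul_left ?_ _
    rw [hc, Nat.cast_mul, Nat.cast_pow]
    exact dvd_mul_right _ _
  -- squeeze
  have heq : Ideal.span {g} = Ideal.span {Lη} :=
    span_singleton_eq_of_X_pow_dvd_of_dvd_of_pow_dvd_coeff hXg hgL halg hanL
  rw [← heq, ← hg']

end Pair

end Summit.BirchSwinnertonDyer.BirchSwinnertonDyer.Theorems

end
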